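/-
Copyright (c) 2026 the pub-hodgecm-mathlib formalisation cell (harness21).  Prover seat hodgecm-mathlib-F0P3a-p07 (g11): road «S3-tree» (LEAD F0P3a-plan (g11), architect
A-p16 (g29) ruling A-81 (1) «SPAN-0-ram»: (b) «htr₀-ram»), brick htr₀-ram «SELF-DUAL TRANSITIVITY WITHOUT A DATUM»; 2026-09-01.
-/
import Literature.NumberTheory.Automorphic.UnitaryLatticeTreeTypeTwoTransitive    -- ★ T1d′ FILE 3 (B-p14 (g35)): `det_gram_three`, `B₀_mulVec_single_eq_gram`, `transpose_of_mulVec_single`; brings ★ T1c `isUnimodularLattice_of_isSelfDualLattice`, ★ `IsUnimodularLattice` API, `eq_one_of_mul_self_eq_one`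
import HarnessLib

/-!
# The lattice graph of a hermitian space — htr₀-ram: `U(σ, J₀)` IS TRANSITIVE ON THE SELF-DUAL VERTICES OF `K³`, WITHOUT A DATUM (unramified and tamely ramified places alike)
# (Jacobowitz 1962 §4, §7–§8; O'Meara §82F; Bruhat–Tits 1972 §10)

Topic `NumberTheory/Automorphic`; namespace `Literature.NumberTheory.Automorphic.UnitaryLatticeTree`.  THEOREMS ONLY (no definition, no instance, no notation, no named fact,
no `sorry`); kernel lane.  Cell `pub/hodgecm-mathlib` (D-0151), crux H413 = `stmt-HodgeConjecture-24833`; road «S3-tree», brick **htr₀-ram** (architect A-81 (1)(b)) = rank-3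
self-dual transitivity at a TAMELY RAMIFIED place, the twin of ★ F0P2-p06 `exists_unitary_mapGL_stdLattice_eq_of_isSelfDualLattice_antidiagonal` (which rests on ★ T1c's Cartan
frame `exists_frame_of_isSelfDualLattice`, `hd : UnramifiedLocalConjDatum σ ϖ`).  THIS FILE PROVES IT FOR `N = 3` WITH NO DATUM AT ALL — hypotheses: `σ` an involution preserving
`v`, `ϖ` a uniformiser, and a trace-one integral element `t + σt = 1` (unramified: the datum's (trace); tamely ramified: `t = 1∕2`) — by an elementary CROSS-PRODUCT construction.
THE MATHEMATICS.  `M` self-dual for `J₀` on `K³` (`M = latt g`, `G = ᵗσ(g)J₀g` unimodular; so `|det g| = 1` by `det G = −N(det g)`, and `M^♯ = M`).  (§1) A PRIMITIVE multiple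
`f₀ = ϖᵏe₀ ∈ M` of the isotropic `e₀` (`ϖ⁻¹f₀ ∉ M`: normalise the column `g⁻¹e₀`); unimodularity gives a partner `y ∈ M`, `h(f₀,y) = 1` (★ `IsUnimodularLattice.exists_apply_eq_one_of_not_mem′`
over the ★ T1c bridge), and `f₂ = y − t·h(y,y)·f₀ ∈ M` is isotropic with `h(f₀,f₂) = 1`.  (§2) THE `σ`-CROSS PRODUCT `n = J₀(σf₀ × σf₂)`: identically `h(f₀,n) = h(f₂,n) = 0` and
`h(m,n) = σ det(m; f₀; f₂)` (rows), and — the Lagrange identity — `h(n,n) = h(f₀,f₂)h(f₂,f₀) − h(f₀,f₀)h(f₂,f₂) = 1`.  Since `det(m; f₀; f₂) ∈ det(g)·𝒪` for `m ∈ M`, `n ∈ M^♯ = M`.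
(§3) `u = (f₀ | n | f₂)` has Gram matrix `J₀`, so `u ∈ U(σ, J₀)` and `u·𝒪³ = latt u ≤ M`; both are unimodular lattices of `K³`, hence equal (★ `IsUnimodularLattice.eq_of_le`).
HONEST LABEL: HC_CM is proved only modulo the 2 remaining named inputs (hLiu418 24832, h413 24833) until rung 0 closes; nothing printed is asserted here (elementary lattice
algebra over a valuation ring with involution); S3 (`stub_N6nsS3id`) stays a print row until the road's END lands.

* §1 `exists_zpow_mul_primitive_of_ne_zero`, `exists_zpow_smul_single_mem_primitive` (a primitive multiple of a basis vector in a full lattice).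
* §2 `B₀_cross_eq_det`, `B₀_left_cross_eq_zero`, `B₀_right_cross_eq_zero`, **`B₀_cross_cross`** (Lagrange), `of_mulVec_eq_of_mul_transpose`.
* §3 **`exists_unitary_mapGL_stdLattice_eq_of_isSelfDualLattice_of_trace`** (= «htr₀» for `J₀` on `K³`, datum-free), `forall_isSelfDualLattice_exists_mapGL_stdLattice_eq_of_neg`
  (the tamely ramified reading, `t = 1∕2`).

## References
* [Jacobowitz1962] R. Jacobowitz, *Hermitian forms over local fields*, Amer. J. Math. 84 (1962), §4, §7 Thm. 7.1, §8 (unimodular lattices, unramified ∕ ramified).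
* [Omeara1963] O. T. O'Meara, *Introduction to Quadratic Forms* (1963), §82F (82:17) (primitive vectors of unimodular lattices have partners).
* [BruhatTits1972] F. Bruhat, J. Tits, *Groupes réductifs sur un corps local I*, Publ. Math. IHÉS 41 (1972), §10 (hyperspecial vertices: one orbit).
-/

set_option autoImplicit false

noncomputable section

open scoped Valued WithZero Matrix MatrixGroups

namespace Literature.NumberTheory.Automorphic.UnitaryLatticeTree

open Literature.NumberTheory.Automorphic Literature.NumberTheory.Automorphic.HermitianLattice
open Literature.NumberTheory.Automorphic.CartanUnique

variable {K : Type*} [Field K] [Valued K ℤᵐ⁰] {σ : K →+* K} {ϖ : K} {N : ℕ}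

/-! ## §1 A primitive multiple of a basis vector in a full lattice -/

/-- **Scaling a non-zero vector to a primitive one**: for `c ≠ 0` in `K^N` some `ϖᵏ·c` (`k ∈ ℤ`) is integral with a unit coordinate. [cite: Omeara1963, §81D] -/
theorem exists_zpow_mul_primitive_of_ne_zero (hϖ : Valued.v ϖ = WithZero.exp (-1 : ℤ)) {c : Fin N → K} (hc : c ≠ 0) :
    ∃ k : ℤ, (∀ i, Valued.v (ϖ ^ k * c i) ≤ 1) ∧ ∃ i, Valued.v (ϖ ^ k * c i) = 1 := by
  obtain ⟨i₁, hi₁⟩ : ∃ i, c i ≠ 0 := by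
    by_contra h
    push Not at h
    exact hc (funext h)
  obtain ⟨i₀, -, hmax⟩ := Finset.exists_max_image Finset.univ (fun i => Valued.v (c i)) ⟨i₁, Finset.mem_univ _⟩
  have hv0 : Valued.v (c i₀) ≠ 0 := fun h0 => by
    have h := hmax i₁ (Finset.mem_univ _)
    rw [h0, le_zero_iff, map_eq_zero] at h
    exact hi₁ h
  set L : ℤ := WithZero.log (Valued.v (c i₀)) with hL
  have hci₀ : Valued.v (c i₀) = WithZero.exp L := (WithZero.exp_log hv0).symm
  refine ⟨L, fun i => ?_, i₀, ?_⟩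
  · rw [map_mul, v_uniformizer_zpow hϖ]
    calc WithZero.exp (-L) * Valued.v (c i) ≤ WithZero.exp (-L) * Valued.v (c i₀) := mul_le_mul_right (hmax i (Finset.mem_univ _)) _
      _ = 1 := by rw [hci₀, ← WithZero.exp_add, neg_add_cancel, WithZero.exp_zero]
  · rw [map_mul, v_uniformizer_zpow hϖ, hci₀, ← WithZero.exp_add, neg_add_cancel, WithZero.exp_zero]

/-- **A PRIMITIVE MULTIPLE OF `e_j` IN A FULL LATTICE**: for `g ∈ GL_N(K)` some `f = ϖᵏe_j` lies in `latt g` with `ϖ⁻¹f ∉ latt g` (normalise the column `g⁻¹e_j`).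
[cite: Omeara1963, §81D] [cite: Serre1980Trees, II.1.1] -/
theorem exists_zpow_smul_single_mem_primitive (hϖ : Valued.v ϖ = WithZero.exp (-1 : ℤ)) (g : GL (Fin N) K) (j : Fin N) :
    ∃ k : ℤ, (ϖ ^ k) • (Pi.single j 1 : Fin N → K) ∈ latt (g : Matrix (Fin N) (Fin N) K) ∧
      ϖ⁻¹ • ((ϖ ^ k) • (Pi.single j 1 : Fin N → K)) ∉ latt (g : Matrix (Fin N) (Fin N) K) := by
  have hdet : IsUnit (g : Matrix (Fin N) (Fin N) K).det := Matrix.isUnits_det_units g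
  set c : Fin N → K := (g : Matrix (Fin N) (Fin N) K)⁻¹.mulVec (Pi.single j 1) with hcdef
  have hc : c ≠ 0 := by
    intro h
    have hgc : (g : Matrix (Fin N) (Fin N) K).mulVec c = Pi.single j 1 := by
      rw [hcdef, Matrix.mulVec_mulVec, Matrix.mul_nonsing_inv _ hdet, Matrix.one_mulVec]
    rw [h, Matrix.mulVec_zero] at hgc
    have hj := congrFun hgc j
    rw [Pi.zero_apply, Pi.single_eq_same] at hj
    exact zero_ne_one hj
  obtain ⟨k, hk, i, hi⟩ := exists_zpow_mul_primitive_of_ne_zero hϖ hc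
  refine ⟨k, ?_, ?_⟩
  · rw [mem_latt_iff_of_isUnit hdet, Matrix.mulVec_smul, mem_stdLattice]
    intro i'
    rw [Pi.smul_apply, smul_eq_mul]; exact hk i'
  · rw [mem_latt_iff_of_isUnit hdet, Matrix.mulVec_smul, Matrix.mulVec_smul, mem_stdLattice, not_forall]
    refine ⟨i, ?_⟩
    rw [Pi.smul_apply, Pi.smul_apply, smul_eq_mul, smul_eq_mul, map_mul, ← hcdef, hi, mul_one, map_inv₀, hϖ, ← WithZero.exp_neg, neg_neg,
      ← WithZero.exp_zero, WithZero.exp_le_exp]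
    omega

/-! ## §2 The `σ`-cross product `n = J₀(σf₀ × σf₂)` -/

omit [Valued K ℤᵐ⁰] in
/-- **Pairing against the cross vector is a determinant**: `h(m, n) = σ·det(m; f₀; f₂)` (rows) for `n = J₀(σf₀ × σf₂)`. [cite: Jacobowitz1962, §4] -/
theorem B₀_cross_eq_det (m f₀ f₂ : Fin 3 → K) :
    B₀ σ 3 m ![σ (f₀ 0) * σ (f₂ 1) - σ (f₀ 1) * σ (f₂ 0), σ (f₀ 2) * σ (f₂ 0) - σ (f₀ 0) * σ (f₂ 2), σ (f₀ 1) * σ (f₂ 2) - σ (f₀ 2) * σ (f₂ 1)] =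
      σ (Matrix.of ![m, f₀, f₂]).det := by
  rw [Matrix.det_fin_three]
  simp [B₀_apply, Fin.sum_univ_three, Fin.rev]
  ring

omit [Valued K ℤᵐ⁰] in
/-- `h(f₀, n) = 0` for the cross vector `n = J₀(σf₀ × σf₂)` (two equal rows). [cite: Jacobowitz1962, §4] -/
theorem B₀_left_cross_eq_zero (f₀ f₂ : Fin 3 → K) :
    B₀ σ 3 f₀ ![σ (f₀ 0) * σ (f₂ 1) - σ (f₀ 1) * σ (f₂ 0), σ (f₀ 2) * σ (f₂ 0) - σ (f₀ 0) * σ (f₂ 2), σ (f₀ 1) * σ (f₂ 2) - σ (f₀ 2) * σ (f₂ 1)] = 0 := by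
  simp [B₀_apply, Fin.sum_univ_three, Fin.rev]
  ring

omit [Valued K ℤᵐ⁰] in
/-- `h(f₂, n) = 0` for the cross vector `n = J₀(σf₀ × σf₂)` (two equal rows). [cite: Jacobowitz1962, §4] -/
theorem B₀_right_cross_eq_zero (f₀ f₂ : Fin 3 → K) :
    B₀ σ 3 f₂ ![σ (f₀ 0) * σ (f₂ 1) - σ (f₀ 1) * σ (f₂ 0), σ (f₀ 2) * σ (f₂ 0) - σ (f₀ 0) * σ (f₂ 2), σ (f₀ 1) * σ (f₂ 2) - σ (f₀ 2) * σ (f₂ 1)] = 0 := by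
  simp [B₀_apply, Fin.sum_univ_three, Fin.rev]
  ring

omit [Valued K ℤᵐ⁰] in
/-- **THE LAGRANGE IDENTITY for the `σ`-cross product** (`σ` an involution): `h(n, n) = h(f₀,f₂)·h(f₂,f₀) − h(f₀,f₀)·h(f₂,f₂)` for `n = J₀(σf₀ × σf₂)`. [cite: Jacobowitz1962, §4] -/
theorem B₀_cross_cross (hσ : ∀ x, σ (σ x) = x) (f₀ f₂ : Fin 3 → K) :
    B₀ σ 3 ![σ (f₀ 0) * σ (f₂ 1) - σ (f₀ 1) * σ (f₂ 0), σ (f₀ 2) * σ (f₂ 0) - σ (f₀ 0) * σ (f₂ 2), σ (f₀ 1) * σ (f₂ 2) - σ (f₀ 2) * σ (f₂ 1)]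
        ![σ (f₀ 0) * σ (f₂ 1) - σ (f₀ 1) * σ (f₂ 0), σ (f₀ 2) * σ (f₂ 0) - σ (f₀ 0) * σ (f₂ 2), σ (f₀ 1) * σ (f₂ 2) - σ (f₀ 2) * σ (f₂ 1)] =
      B₀ σ 3 f₀ f₂ * B₀ σ 3 f₂ f₀ - B₀ σ 3 f₀ f₀ * B₀ σ 3 f₂ f₂ := by
  simp [B₀_apply, Fin.sum_univ_three, Fin.rev, hσ]
  ring

omit [Valued K ℤᵐ⁰] in
/-- Rows which are images under `g`: `(g·r₀; g·r₁; g·r₂) = (r₀; r₁; r₂)·gᵀ`, so `det(g·r₀; g·r₁; g·r₂) = det(r₀; r₁; r₂)·det g`. [cite: Jacobowitz1962, §4] -/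
theorem of_mulVec_eq_of_mul_transpose (g : Matrix (Fin 3) (Fin 3) K) (r₀ r₁ r₂ : Fin 3 → K) :
    Matrix.of ![g.mulVec r₀, g.mulVec r₁, g.mulVec r₂] = Matrix.of ![r₀, r₁, r₂] * gᵀ := by
  ext i j
  fin_cases i <;> simp [Matrix.mul_apply, Matrix.mulVec, dotProduct, Fin.sum_univ_three, mul_comm]

/-! ## §3 Self-dual transitivity for `J₀` on `K³`, datum-free -/

set_option maxHeartbeats 800000 in
/-- **`U(σ, J₀)` IS TRANSITIVE ON THE SELF-DUAL VERTICES OF `K³` — WITHOUT A DATUM.**  `σ` an involution preserving `v`, `ϖ` a uniformiser, `t + σt = 1` with `t ∈ 𝒪`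
(unramified: the datum's (trace); tamely ramified: `t = 1∕2`).  Every self-dual `M` (for `J₀`, any scaling parameter `ϖ′`) is `u·𝒪³` with `u ∈ U(σ, J₀)`: primitive isotropic
`f₀ = ϖᵏe₀ ∈ M`, partner `y` (`h(f₀,y) = 1`), isotropic `f₂ = y − t·h(y,y)·f₀` with `h(f₀,f₂) = 1`, and the cross vector `n = J₀(σf₀ × σf₂) ∈ M^♯ = M` with `h(n,n) = 1`, `n ⊥ f₀, f₂`;
`u = (f₀ | n | f₂)` has Gram `J₀` and `u·𝒪³ ≤ M`, both unimodular ⇒ equal.  (Twin — and datum-free strengthening at `N = 3` — of ★ F0P2-p06's Cartan-based lemma.)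
[cite: Jacobowitz1962, §7 Thm. 7.1, §8] [cite: Omeara1963, §82F (82:17)] [cite: BruhatTits1972, §10] -/
theorem exists_unitary_mapGL_stdLattice_eq_of_isSelfDualLattice_of_trace (hσ : ∀ x, σ (σ x) = x) (hvσ : ∀ a, Valued.v (σ a) = Valued.v a)
    (hϖ : Valued.v ϖ = WithZero.exp (-1 : ℤ)) (htrace : ∃ t : K, Valued.v t ≤ 1 ∧ t + σ t = 1)
    {ϖ' : K} {M : Submodule 𝒪[K] (Fin 3 → K)} (hM : IsSelfDualLattice σ ϖ' ((StdForm.antidiagonal 3).over K) M) :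
    ∃ u : unitaryGroupOfForm σ ((StdForm.antidiagonal 3).over K), mapGL (u : GL (Fin 3) K) (stdLattice K 3) = M := by
  have hϖ0 : ϖ ≠ 0 := uniformizer_ne_zero hϖ
  have hϖ1 : Valued.v ϖ ≤ 1 := by rw [hϖ, ← WithZero.exp_zero]; exact WithZero.exp_le_exp.2 (by norm_num)
  obtain ⟨t, ht1, htt⟩ := htrace
  have herm : ∀ y z : Fin 3 → K, B₀ σ 3 z y = σ (B₀ σ 3 y z) := fun y z => (isHermitianForm_B₀ hσ y z).symm
  have hL : IsUnimodularLattice (B₀ σ 3) (frame K 3 Finset.univ) M := isUnimodularLattice_of_isSelfDualLattice hvσ hM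
  obtain ⟨g, hMg, hGint, -, hGdet⟩ := id hM
  rw [pow_zero] at hGdet
  -- `|det g| = 1`
  have hvg : Valued.v (g : Matrix (Fin 3) (Fin 3) K).det = 1 := by
    have h : (formCongr σ g ((StdForm.antidiagonal 3).over K)).det = -(σ (g : Matrix (Fin 3) (Fin 3) K).det * (g : Matrix (Fin 3) (Fin 3) K).det) :=
      det_gram_three (σ := σ) (g : Matrix (Fin 3) (Fin 3) K)
    rw [h, Valuation.map_neg, map_mul, hvσ] at hGdet
    exact eq_one_of_mul_self_eq_one hGdet
  -- §1: the primitive isotropic `f₀ = ϖᵏ e₀ ∈ M` and its partner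
  obtain ⟨k, hf₀M, hprim⟩ := exists_zpow_smul_single_mem_primitive hϖ g 0
  rw [← hMg] at hf₀M hprim
  set f₀ : Fin 3 → K := (ϖ ^ k) • (Pi.single 0 1 : Fin 3 → K) with hf₀
  have hf₀f₀ : B₀ σ 3 f₀ f₀ = 0 := by
    rw [hf₀, form_smul_left, form_smul_right, B₀_single_single, if_neg (by decide), mul_zero, mul_zero]
  obtain ⟨y, hyM, hf₀y⟩ := hL.exists_apply_eq_one_of_not_mem' hϖ hvσ (isHermitianForm_B₀ hσ) hf₀M hprim
  have hyf₀ : B₀ σ 3 y f₀ = 1 := by rw [herm, hf₀y, map_one]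
  have hηv : Valued.v (B₀ σ 3 y y) ≤ 1 := hL.integral y hyM y hyM
  have hση : σ (B₀ σ 3 y y) = B₀ σ 3 y y := (isHermitianForm_B₀ hσ).apply_self y
  -- the isotropic partner `f₂ = y + ν f₀`, `ν = −t·h(y,y)`
  set ν : K := -(t * B₀ σ 3 y y) with hν
  have hvν : Valued.v ν ≤ 1 := by rw [hν, Valuation.map_neg, map_mul]; exact mul_le_one' ht1 hηv
  have hσν : σ ν = -(σ t * B₀ σ 3 y y) := by rw [hν, map_neg, map_mul, hση]
  set f₂ : Fin 3 → K := y + ν • f₀ with hf₂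
  have hf₂M : f₂ ∈ M := M.add_mem hyM (smul_mem_of_v_le _ hvν hf₀M)
  have hf₀f₂ : B₀ σ 3 f₀ f₂ = 1 := by rw [hf₂, map_add, form_smul_right, hf₀y, hf₀f₀, mul_zero, add_zero]
  have hf₂f₀ : B₀ σ 3 f₂ f₀ = 1 := by rw [herm, hf₀f₂, map_one]
  have hf₂f₂ : B₀ σ 3 f₂ f₂ = 0 := by
    have h : B₀ σ 3 f₂ f₂ = B₀ σ 3 y y + ν + σ ν := by
      simp only [hf₂, map_add, LinearMap.add_apply, form_smul_left, form_smul_right, hyf₀, hf₀y, hf₀f₀]; ring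
    rw [h, hσν, hν]
    linear_combination (-(B₀ σ 3 y y)) * htt
  -- §2: the cross vector `n`
  set n : Fin 3 → K := ![σ (f₀ 0) * σ (f₂ 1) - σ (f₀ 1) * σ (f₂ 0), σ (f₀ 2) * σ (f₂ 0) - σ (f₀ 0) * σ (f₂ 2), σ (f₀ 1) * σ (f₂ 2) - σ (f₀ 2) * σ (f₂ 1)] with hn
  have hf₀n : B₀ σ 3 f₀ n = 0 := B₀_left_cross_eq_zero f₀ f₂
  have hf₂n : B₀ σ 3 f₂ n = 0 := B₀_right_cross_eq_zero f₀ f₂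
  have hnf₀ : B₀ σ 3 n f₀ = 0 := by rw [herm, hf₀n, map_zero]
  have hnf₂ : B₀ σ 3 n f₂ = 0 := by rw [herm, hf₂n, map_zero]
  have hnn : B₀ σ 3 n n = 1 := by rw [hn, B₀_cross_cross hσ, hf₀f₂, hf₂f₀, hf₀f₀, hf₂f₂]; ring
  -- `n ∈ M^♯ = M`
  have hnM : n ∈ M := by
    rw [← dualLatt_eq_self_of_isSelfDualLattice hvσ isUnit_det_antidiagonal hM, mem_dualLatt]
    intro m hm
    rw [pairing_antidiagonal, hn, B₀_cross_eq_det, hvσ]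
    -- coordinates: `m = g m′`, `f₀ = g a′`, `f₂ = g b′` with integral `m′, a′, b′`
    rw [hMg] at hm hf₀M hf₂M
    obtain ⟨m', hm', hmeq⟩ := Submodule.mem_map.1 hm
    obtain ⟨a', ha', haeq⟩ := Submodule.mem_map.1 hf₀M
    obtain ⟨b', hb', hbeq⟩ := Submodule.mem_map.1 hf₂M
    rw [LinearMap.restrictScalars_apply, Matrix.toLin'_apply] at hmeq haeq hbeq
    rw [← hmeq, ← haeq, ← hbeq, of_mulVec_eq_of_mul_transpose, Matrix.det_mul, Matrix.det_transpose, map_mul, hvg, mul_one]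
    refine v_det_le_one_of_forall_v_le_one fun i j => ?_
    fin_cases i
    · exact hm' j
    · exact ha' j
    · exact hb' j
  -- §3: the unitary matrix `u = (f₀ | n | f₂)`
  set U : Matrix (Fin 3) (Fin 3) K := (Matrix.of ![f₀, n, f₂])ᵀ with hU
  have hU0 : U.mulVec (Pi.single 0 1) = f₀ := transpose_of_mulVec_single _ 0
  have hU1 : U.mulVec (Pi.single 1 1) = n := transpose_of_mulVec_single _ 1
  have hU2 : U.mulVec (Pi.single 2 1) = f₂ := transpose_of_mulVec_single _ 2
  have hUJ : (U.map σ)ᵀ * (StdForm.antidiagonal 3).over K * U = (StdForm.antidiagonal 3).over K := by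
    ext i j
    rw [← B₀_mulVec_single_eq_gram, UnitaryGroup.antidiagonal_three_over_eq]
    fin_cases i <;> fin_cases j <;>
      simp only [Fin.zero_eta, Fin.mk_one, Fin.reduceFinMk, hU0, hU1, hU2, hf₀f₀, hf₀n, hf₀f₂, hnf₀, hnn, hnf₂, hf₂f₀, hf₂n, hf₂f₂] <;> rfl
  have hdetU : U.det ≠ 0 := by
    intro h
    have h2 := congrArg Matrix.det hUJ
    rw [det_gram_three, h, mul_zero, neg_zero, det_antidiagonal_three] at h2
    norm_num at h2
  set u : GL (Fin 3) K := Matrix.GeneralLinearGroup.mkOfDetNeZero U hdetU with hu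
  have huval : (u : Matrix (Fin 3) (Fin 3) K) = U := rfl
  have huU : u ∈ unitaryGroupOfForm σ ((StdForm.antidiagonal 3).over K) := by rw [mem_unitaryGroupOfForm_iff, huval]; exact hUJ
  refine ⟨⟨u, huU⟩, ?_⟩
  change mapGL u (stdLattice K 3) = M
  have hlatt : mapGL u (stdLattice K 3) = latt U := by rw [← latt_one, mapGL_latt_eq, huval, Matrix.mul_one]
  -- `u·𝒪³ ≤ M`
  have hle : mapGL u (stdLattice K 3) ≤ M := by
    rw [hlatt, latt_le_iff_forall_mulVec_single_mem]
    intro j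
    fin_cases j
    · simp only [Fin.zero_eta]; rw [hU0]; exact hf₀M
    · simp only [Fin.mk_one]; rw [hU1]; exact hnM
    · simp only [Fin.reduceFinMk]; rw [hU2]; exact hf₂M
  -- both unimodular ⇒ equal
  have hJ : ∀ i j : Fin 3, (StdForm.antidiagonal 3).over K i j = if j = Fin.rev i then (1 : K) else 0 := by
    intro i j
    simp only [StdForm.over, Matrix.map_apply, StdForm.antidiagonal_J_apply]
    split_ifs <;> simp
  have h0 : IsSelfDualLattice σ ϖ ((StdForm.antidiagonal 3).over K) (mapGL u (stdLattice K 3)) := by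
    refine isVertexLattice_mapGL σ ϖ _ u huU (isSelfDualLattice_stdLattice (fun i j => ?_) (fun i j => ?_) ?_ hϖ1)
    · rw [hJ]; split_ifs <;> simp
    · rw [StdForm.inv_over, hJ]; split_ifs <;> simp
    · rw [det_antidiagonal_three, Valuation.map_neg, map_one]
  exact IsUnimodularLattice.eq_of_le hL (isUnimodularLattice_of_isSelfDualLattice hvσ h0) hle

/-- **«htr₀-ram»: at a TAMELY RAMIFIED place every self-dual vertex of `(K³, J₀)` is `u·𝒪³`, `u ∈ U(σ, J₀)`** — the reading of the datum-free theorem with the trace element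
`t = 1∕2` (`|2| = 1`); the hypotheses `σϖ = −ϖ`, `hres` of the ramified block are not even needed. [cite: Jacobowitz1962, §8] [cite: BruhatTits1972, §10] -/
theorem forall_isSelfDualLattice_exists_mapGL_stdLattice_eq_of_two (hσ : ∀ x, σ (σ x) = x) (hvσ : ∀ a, Valued.v (σ a) = Valued.v a)
    (hϖ : Valued.v ϖ = WithZero.exp (-1 : ℤ)) (h2 : Valued.v (2 : K) = 1) {ϖ' : K} :
    ∀ M : Submodule 𝒪[K] (Fin 3 → K), IsSelfDualLattice σ ϖ' ((StdForm.antidiagonal 3).over K) M →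
      ∃ u : unitaryGroupOfForm σ ((StdForm.antidiagonal 3).over K), mapGL (u : GL (Fin 3) K) (stdLattice K 3) = M := by
  have h20 : (2 : K) ≠ 0 := fun h => by rw [h, map_zero] at h2; exact zero_ne_one h2
  intro M hM
  exact exists_unitary_mapGL_stdLattice_eq_of_isSelfDualLattice_of_trace hσ hvσ hϖ
    ⟨1 / 2, by rw [map_div₀, map_one, h2, div_one], by rw [map_div₀, map_one, map_ofNat, ← add_div, one_add_one_eq_two, div_self h20]⟩ hM

end Literature.NumberTheory.Automorphic.UnitaryLatticeTree

end
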